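import Mathlib
import HarnessLib
import Literature.Analysis.FluidPDE.Tao2016AveragedNS.LocalCascadeSolutions
import Literature.Analysis.FluidPDE.Tao2016AveragedNS.RenormalisedCascadeWaves
import Summits.NavierStokesRegularity.NavierStokesRegularity.Theorems.WakeRatchetMinimalViscousBlowupClosedValve
import Summits.NavierStokesRegularity.NavierStokesRegularity.Theorems.WakeRatchetMinimalViscousBlowupEveryShellFires

/-!
# Crux `TaoLadderRungTwoBreak.EternalRigidityViscBddOne` (stmt-NavierStokesRegularity-20420): the RISE-TIME DISSIPATION of one shell of
# the viscous lattice — a shell that climbs from empty to the level `a²` under the energy bound `S` dissipates `≥ 3νλ^{2n}a³/(4096 λ^{5n/2} S)`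

MODEL lattice ODEs only (Tao 2016 §4: the exact NS-scaled `ν`-viscous cascade lattice of a cancelling table, `m = 4`); nothing here is a
statement about the Navier–Stokes equations; no stub, crux or summit is closed (`--supports stmt-NavierStokesRegularity-20420`).  `λ = 1+ε₀`.
The analytic input of `…EternalRigidityViscBddOneReynoldsThreshold` (the blow-up threshold in `Σ_i X₀ᵢ²/ν²` DIVERGES as `ε₀ → 0` at fixed
spread): there the firing floor puts every shell at the level `a² = c₀ν²λ^{−n}` at some time, and this file converts each such passage into
dissipated energy.

* `blockEnergy_single` — the one-shell block energy of the tree's `hasDerivWithinAt_blockEnergy` is `½‖X_n‖²`;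
* `rise_dissipation` — cancelling table with `|α_{··(0,0,1)}| ≤ 1`, a trajectory of the `ν`-viscous lattice on `[0,T)` (`C¹`, motion clause,
  `ν ≥ 0`) with the energy bound `‖X_k(t)‖² ≤ S` on `[0,T)`, a shell `n` EMPTY at `t = 0` reaching `‖X_n(t₁)‖² ≥ a²` (`a > 0`) at some
  `t₁ ≤ T' < T`: then `3a³ ≤ 4096·w·S·∫_{(0,T']}‖X_n‖²` for every `w ≥ λ^{5n/2}`.  Proof: the shell energy identity
  `(½‖X_n‖²)' = Π_{n−1} − Π_n − νλ^{2n}‖X_n‖²` (`hasDerivWithinAt_blockEnergy`) with the bond-flux bounds `|Π_k| ≤ 4³λ^{5k/2}‖X_k‖²‖X_{k+1}‖`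
  (`abs_botSum_le_norm_shellVec`) gives the RATE BOUND `(½‖X_n‖²)' ≤ 128·w·S·a` wherever `‖X_n‖ ≤ a`; the first-crossing times
  `s₁ < s₂` of the levels `a²/8` and `a²/2` (closed sublevel sets, `sInf`/`sSup`) bound a passage of duration `≥ 3a/(1024 w S)` (monotone
  potential `128wSa·t − ½‖X_n(t)‖²`, `monotoneOn_of_hasDerivWithinAt_nonneg`) on which `‖X_n‖² ≥ a²/4`, and the window integral dominates
  the passage integral.

HONEST LABEL: an a-priori estimate for model trajectories; (ω3) `stub_typeOne`, (ω4) `stub_eternalLimitViscBdd`, ⟨20420⟩ and every NS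
statement remain OPEN; rung 0.
-/

noncomputable section

-- the summit and its single sub-problem share the name (CONVENTIONS §1)
set_option linter.dupNamespace false

namespace Summit.NavierStokesRegularity.NavierStokesRegularity.Theorems.EternalRigidityViscBddOne.RiseDissipation

open Set Filter Topology MeasureTheory
open Literature.Analysis.FluidPDE Literature.Analysis.FluidPDE.TaoCascade
open Summit.NavierStokesRegularity.NavierStokesRegularity.Theorems.MinimalViscousBlowup.ThresholdRay

/-! ## The rise-time dissipation of one shell -/

/-- The one-shell block energy is half the squared shell norm: `Σ_{k ∈ [n,n+1)} Σ_i ½X_{i,k}² = ½‖X_n‖²`. [folklore] -/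
theorem blockEnergy_single (X : Fin 4 → ℤ → ℝ → ℝ) (n : ℕ) (t : ℝ) :
    ∑ k ∈ Finset.Ico n (n + 1), ∑ i : Fin 4, (1 / 2 : ℝ) * X i k t ^ 2 = (1 / 2 : ℝ) * ‖shellVec X n t‖ ^ 2 := by
  rw [Finset.sum_Ico_succ_top (le_refl n), Finset.Ico_self, Finset.sum_empty, zero_add, norm_shellVec_sq,
    Finset.mul_sum]

/-- **RISE-TIME DISSIPATION of one shell.**  Cancelling table with `|α_{··(0,0,1)}| ≤ 1`; a trajectory of the `ν`-viscous lattice on `[0,T)`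
(`C¹`, motion clause) with the energy bound `‖X_k(t)‖² ≤ S` on `[0,T)`; a shell `n` EMPTY at `t = 0` which reaches `‖X_n(t₁)‖² ≥ a²`
(`a > 0`) at some `t₁ ≤ T' < T`.  Then, for every `w ≥ λ^{5n/2}`, `3a³ ≤ 4096·w·S·∫_{(0,T']} ‖X_n(t)‖² dt`: the passage of `½‖X_n‖²`
from `a²/8` to `a²/2` takes time `≥ 3a/(1024 w S)` (its rate is `≤ |Π_{n−1}| + |Π_n| ≤ 128 w S a` below the level `a`), and on it
`‖X_n‖² ≥ a²/4`. [cite: Tao2016AveragedNS, §4 proof of (4.13) (shell energy identity under (4.3)), (4.1)–(4.2) (bond fluxes)] -/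
theorem rise_dissipation {ε₀ ν T T' S a w : ℝ} (hε : 0 < ε₀) (hν : 0 ≤ ν)
    {α : Fin 4 → Fin 4 → Fin 4 → ℤ × ℤ × ℤ → ℝ} (hcan : IsCancellingCoeff α)
    (hα1 : ∀ i₁ i₂ i₃, |α i₁ i₂ i₃ (0, 0, 1)| ≤ 1) {X : Fin 4 → ℤ → ℝ → ℝ}
    (hcd : ∀ i n, ContDiffOn ℝ 1 (X i n) (Ico 0 T))
    (hmot : ∀ i n t, 0 ≤ t → t < T → derivWithin (X i n) (Ici 0) t =
      quadTerm ε₀ α X i n t - ν * (1 + ε₀) ^ ((2 : ℝ) * n) * X i n t)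
    (hE : ∀ (k : ℤ) (t : ℝ), 0 ≤ t → t < T → ‖shellVec X k t‖ ^ 2 ≤ S)
    (n : ℕ) (hn0 : ∀ i : Fin 4, X i n 0 = 0) (hw : (1 + ε₀) ^ ((5 : ℝ) * n / 2) ≤ w)
    (ha : 0 < a) {t₁ : ℝ} (ht₁0 : 0 ≤ t₁) (ht₁T' : t₁ ≤ T') (hT'T : T' < T)
    (hfire : a ^ 2 ≤ ‖shellVec X n t₁‖ ^ 2) :
    3 * a ^ 3 ≤ 4096 * w * S * ∫ t in Ioc 0 T', ‖shellVec X n t‖ ^ 2 := by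
  have hl0 : (0 : ℝ) < 1 + ε₀ := by linarith
  have hl1 : (1 : ℝ) ≤ 1 + ε₀ := by linarith
  have ht₁T : t₁ < T := lt_of_le_of_lt ht₁T' hT'T
  have hT'0 : 0 ≤ T' := ht₁0.trans ht₁T'
  -- `a² ≤ S`, `0 < S`, `0 < w`
  have haS : a ^ 2 ≤ S := hfire.trans (hE n t₁ ht₁0 ht₁T)
  have hS0 : 0 < S := lt_of_lt_of_le (by positivity) haS
  have hw0 : 0 < w := lt_of_lt_of_le (Real.rpow_pos_of_pos hl0 _) hw
  -- the larger window and the derivative of the one-shell energy `e = ½‖X_n‖²`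
  set T'' : ℝ := (T' + T) / 2 with hT''
  have hT'T'' : T' < T'' := by rw [hT'']; linarith
  have hT''T : T'' < T := by rw [hT'']; linarith
  have hderW := hasDerivWithinAt_window_of_clauses (ε₀ := ε₀) (ν := ν) (α := α) hcd hmot hT''T
  set e : ℝ → ℝ := fun t => ∑ k ∈ Finset.Ico n (n + 1), ∑ i : Fin 4, (1 / 2 : ℝ) * X i k t ^ 2 with hedef
  have he : ∀ t, e t = (1 / 2 : ℝ) * ‖shellVec X n t‖ ^ 2 := fun t => blockEnergy_single X n t
  set D : ℝ → ℝ := fun u => ν * ∑ k ∈ Finset.Ico n (n + 1), (1 + ε₀) ^ ((2 : ℝ) * (k : ℤ)) * ∑ i : Fin 4, X i k u ^ 2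
    with hDdef
  set e' : ℝ → ℝ := fun u => botSum ε₀ α X ((n : ℤ) - 1) u - botSum ε₀ α X (n : ℤ) u - D u with he'def
  have heder : ∀ u ∈ Icc (0 : ℝ) T'', HasDerivWithinAt e (e' u) (Icc 0 T'') u := by
    intro u hu
    have h := hasDerivWithinAt_blockEnergy (ε₀ := ε₀) (ν := ν) (K := n) (L := n + 1) hcan
      (fun i j => hderW i j u hu) (by omega)
    have e1 : (((n + 1 : ℕ) : ℤ) - 1) = (n : ℤ) := by push_cast; ring
    rw [e1] at h
    exact h
  have hecont : ContinuousOn e (Icc 0 T'') := fun u hu => (heder u hu).continuousWithinAt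
  have hD0 : ∀ u, 0 ≤ D u := fun u => by
    rw [hDdef]; dsimp only
    exact mul_nonneg hν (Finset.sum_nonneg fun k _ =>
      mul_nonneg (Real.rpow_nonneg hl0.le _) (Finset.sum_nonneg fun i _ => sq_nonneg _))
  have he0 : e 0 = 0 := by
    rw [he, norm_shellVec_sq]; simp [hn0]
  -- THE RATE BOUND below the level `a`: `e' u ≤ 128 w S a`
  set ρ : ℝ := 128 * w * S * a with hρ
  have hρ0 : 0 < ρ := by rw [hρ]; positivity
  have hrate : ∀ u, 0 ≤ u → u < T → e u ≤ a ^ 2 / 2 → e' u ≤ ρ := by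
    intro u hu0 huT heu
    have hXn : ‖shellVec X n u‖ ≤ a := by
      have h1 : ‖shellVec X n u‖ ^ 2 ≤ a ^ 2 := by rw [he] at heu; linarith
      exact (pow_le_pow_iff_left₀ (norm_nonneg _) ha.le two_ne_zero).1 h1
    have hXn0 : 0 ≤ ‖shellVec X (n : ℤ) u‖ := norm_nonneg _
    have hXm : ‖shellVec X ((n : ℤ) - 1) u‖ ^ 2 ≤ S := hE _ u hu0 huT
    have hXp : ‖shellVec X ((n : ℤ) + 1) u‖ ^ 2 ≤ S := hE _ u hu0 huT
    have hXp0 : 0 ≤ ‖shellVec X ((n : ℤ) + 1) u‖ := norm_nonneg _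
    -- weights
    have hwn : (1 + ε₀) ^ ((5 : ℝ) * ((n : ℤ) : ℝ) / 2) ≤ w := by
      rw [show (((n : ℤ) : ℝ)) = (n : ℝ) from Int.cast_natCast n]; exact hw
    have hwm : (1 + ε₀) ^ ((5 : ℝ) * ((((n : ℤ) - 1 : ℤ)) : ℝ) / 2) ≤ w := by
      refine le_trans (Real.rpow_le_rpow_of_exponent_le hl1 ?_) hwn
      push_cast; linarith
    -- the two bond fluxes
    have hB1 := abs_botSum_le_norm_shellVec (m := 4) hl0 hα1 X ((n : ℤ) - 1) u
    rw [sub_add_cancel] at hB1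
    have hB2 := abs_botSum_le_norm_shellVec (m := 4) hl0 hα1 X (n : ℤ) u
    have h4 : ((4 : ℕ) : ℝ) ^ 3 = 64 := by norm_num
    rw [h4] at hB1 hB2
    have hflux1 : |botSum ε₀ α X ((n : ℤ) - 1) u| ≤ 64 * w * S * a := by
      refine hB1.trans ?_
      have : (1 + ε₀) ^ ((5 : ℝ) * ((((n : ℤ) - 1 : ℤ)) : ℝ) / 2) * ‖shellVec X ((n : ℤ) - 1) u‖ ^ 2 *
          ‖shellVec X (n : ℤ) u‖ ≤ w * S * a := by
        exact mul_le_mul (mul_le_mul hwm hXm (sq_nonneg _) hw0.le) hXn hXn0 (by positivity)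
      linarith
    have hflux2 : |botSum ε₀ α X (n : ℤ) u| ≤ 64 * w * S * a := by
      refine hB2.trans ?_
      -- `‖X_n‖²‖X_{n+1}‖ ≤ a · (‖X_n‖² + ‖X_{n+1}‖²)/2 ≤ a (a² + S)/2 ≤ a S`
      have hprod : ‖shellVec X (n : ℤ) u‖ ^ 2 * ‖shellVec X ((n : ℤ) + 1) u‖ ≤ S * a := by
        have h1 : ‖shellVec X (n : ℤ) u‖ * ‖shellVec X ((n : ℤ) + 1) u‖ ≤
            (‖shellVec X (n : ℤ) u‖ ^ 2 + ‖shellVec X ((n : ℤ) + 1) u‖ ^ 2) / 2 := by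
          nlinarith [sq_nonneg (‖shellVec X (n : ℤ) u‖ - ‖shellVec X ((n : ℤ) + 1) u‖)]
        have h2 : (‖shellVec X (n : ℤ) u‖ ^ 2 + ‖shellVec X ((n : ℤ) + 1) u‖ ^ 2) / 2 ≤ S := by
          have h3 : ‖shellVec X (n : ℤ) u‖ ^ 2 ≤ a ^ 2 := pow_le_pow_left₀ hXn0 hXn 2
          linarith
        calc ‖shellVec X (n : ℤ) u‖ ^ 2 * ‖shellVec X ((n : ℤ) + 1) u‖
            = ‖shellVec X (n : ℤ) u‖ * (‖shellVec X (n : ℤ) u‖ * ‖shellVec X ((n : ℤ) + 1) u‖) := by ring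
          _ ≤ a * S := mul_le_mul hXn (h1.trans h2) (by positivity) ha.le
          _ = S * a := by ring
      have hp : 0 ≤ (1 + ε₀) ^ ((5 : ℝ) * ((n : ℤ) : ℝ) / 2) := Real.rpow_nonneg hl0.le _
      have : (1 + ε₀) ^ ((5 : ℝ) * ((n : ℤ) : ℝ) / 2) * ‖shellVec X (n : ℤ) u‖ ^ 2 * ‖shellVec X ((n : ℤ) + 1) u‖
          ≤ w * (S * a) := by
        rw [mul_assoc]
        exact mul_le_mul hwn hprod (by positivity) hw0.le
      linarith
    rw [he'def]; dsimp only
    have hDu := hD0 u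
    rw [hρ]
    linarith [le_abs_self (botSum ε₀ α X ((n : ℤ) - 1) u), neg_abs_le (botSum ε₀ α X (n : ℤ) u)]
  -- FIRST-CROSSING TIMES on `[0,t₁]`: `s₂` = first time `e ≥ a²/2`, `s₁` = last time before `s₂` with `e ≤ a²/8`
  have het₁ : a ^ 2 / 2 ≤ e t₁ := by rw [he]; linarith
  have hcont₁ : ContinuousOn e (Icc 0 t₁) := hecont.mono (Icc_subset_Icc_right (ht₁T'.trans hT'T''.le))
  set A₂ : Set ℝ := Icc 0 t₁ ∩ e ⁻¹' (Ici (a ^ 2 / 2)) with hA₂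
  have hA₂c : IsClosed A₂ := hcont₁.preimage_isClosed_of_isClosed isClosed_Icc isClosed_Ici
  have hA₂n : A₂.Nonempty := ⟨t₁, ⟨ht₁0, le_rfl⟩, het₁⟩
  have hA₂b : BddBelow A₂ := ⟨0, fun t ht => ht.1.1⟩
  set s₂ : ℝ := sInf A₂ with hs₂
  have hs₂mem : s₂ ∈ A₂ := hA₂c.csInf_mem hA₂n hA₂b
  have hs₂0 : 0 ≤ s₂ := hs₂mem.1.1
  have hs₂t₁ : s₂ ≤ t₁ := hs₂mem.1.2
  have hes₂ : a ^ 2 / 2 ≤ e s₂ := hs₂mem.2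
  have hbelow₂ : ∀ t, 0 ≤ t → t < s₂ → e t < a ^ 2 / 2 := by
    intro t ht0 hts
    by_contra h
    have hmem : t ∈ A₂ := ⟨⟨ht0, (hts.le.trans hs₂t₁)⟩, not_lt.1 h⟩
    exact absurd (csInf_le hA₂b hmem) (not_le.2 hts)
  have hcont₂ : ContinuousOn e (Icc 0 s₂) := hcont₁.mono (Icc_subset_Icc_right hs₂t₁)
  set A₁ : Set ℝ := Icc 0 s₂ ∩ e ⁻¹' (Iic (a ^ 2 / 8)) with hA₁
  have hA₁c : IsClosed A₁ := hcont₂.preimage_isClosed_of_isClosed isClosed_Icc isClosed_Iic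
  have hA₁n : A₁.Nonempty := ⟨0, ⟨le_rfl, hs₂0⟩, by show e 0 ≤ a ^ 2 / 8; rw [he0]; positivity⟩
  have hA₁b : BddAbove A₁ := ⟨s₂, fun t ht => ht.1.2⟩
  set s₁ : ℝ := sSup A₁ with hs₁
  have hs₁mem : s₁ ∈ A₁ := hA₁c.csSup_mem hA₁n hA₁b
  have hs₁0 : 0 ≤ s₁ := hs₁mem.1.1
  have hs₁s₂ : s₁ ≤ s₂ := hs₁mem.1.2
  have hes₁ : e s₁ ≤ a ^ 2 / 8 := hs₁mem.2
  have habove₁ : ∀ t, s₁ < t → t ≤ s₂ → a ^ 2 / 8 < e t := by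
    intro t hst hts
    by_contra h
    have hmem : t ∈ A₁ := ⟨⟨hs₁0.trans hst.le, hts⟩, not_lt.1 h⟩
    exact absurd (le_csSup hA₁b hmem) (not_le.2 hst)
  have hs₁lt : s₁ < s₂ := by
    rcases eq_or_lt_of_le hs₁s₂ with h | h
    · exfalso; rw [h] at hes₁; nlinarith [pow_pos ha 2]
    · exact h
  have hs₂T : s₂ < T := lt_of_le_of_lt hs₂t₁ ht₁T
  -- THE RISE TIME: `e s₂ − e s₁ ≤ ρ (s₂ − s₁)` (monotone potential `ρ·w − e(w)` on `[s₁,s₂]`)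
  have hrise : 3 * a ^ 2 / 8 ≤ ρ * (s₂ - s₁) := by
    set g : ℝ → ℝ := fun x => ρ * x - e x with hg
    have hgc : ContinuousOn g (Icc s₁ s₂) := by
      have hsub : Icc s₁ s₂ ⊆ Icc 0 T'' := fun x hx =>
        ⟨hs₁0.trans hx.1, hx.2.trans (hs₂t₁.trans (ht₁T'.trans hT'T''.le))⟩
      exact (continuousOn_const.mul continuousOn_id).sub (hecont.mono hsub)
    have hgd : ∀ x ∈ interior (Icc s₁ s₂), HasDerivWithinAt g (ρ - e' x) (interior (Icc s₁ s₂)) x := by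
      intro x hx
      rw [interior_Icc] at hx ⊢
      have hx' : x ∈ Icc (0 : ℝ) T'' :=
        ⟨hs₁0.trans hx.1.le, hx.2.le.trans (hs₂t₁.trans (ht₁T'.trans hT'T''.le))⟩
      have h1 : HasDerivWithinAt (fun y => ρ * y) ρ (Ioo s₁ s₂) x := by
        simpa using ((hasDerivAt_id x).const_mul ρ).hasDerivWithinAt
      exact h1.sub ((heder x hx').mono fun y hy =>
        ⟨hs₁0.trans hy.1.le, hy.2.le.trans (hs₂t₁.trans (ht₁T'.trans hT'T''.le))⟩)
    have hgd0 : ∀ x ∈ interior (Icc s₁ s₂), 0 ≤ ρ - e' x := by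
      intro x hx
      rw [interior_Icc] at hx
      have hx0 : 0 ≤ x := hs₁0.trans hx.1.le
      have h := hrate x hx0 (lt_of_lt_of_le hx.2 hs₂T.le) (hbelow₂ x hx0 hx.2).le
      linarith
    have hmono := monotoneOn_of_hasDerivWithinAt_nonneg (convex_Icc s₁ s₂) hgc hgd hgd0
    have h := hmono (left_mem_Icc.2 hs₁s₂) (right_mem_Icc.2 hs₁s₂) hs₁s₂
    rw [hg] at h; dsimp only at h
    linarith
  -- THE DISSIPATION on `(s₁, s₂]`: `‖X_n‖² ≥ a²/4` there
  have hXc : ∀ i : Fin 4, ContinuousOn (fun t => X i n t) (Icc 0 T') := fun i =>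
    ((hcd i n).continuousOn).mono fun t ht => ⟨ht.1, lt_of_le_of_lt ht.2 hT'T⟩
  have hfint : IntegrableOn (fun t => ‖shellVec X n t‖ ^ 2) (Ioc 0 T') := by
    have h1 : ContinuousOn (fun t => ∑ i : Fin 4, X i n t ^ 2) (Icc 0 T') :=
      continuousOn_finsetSum _ fun i _ => (hXc i).pow 2
    have h2 : (fun t => ‖shellVec X (n : ℤ) t‖ ^ 2) = fun t => ∑ i : Fin 4, X i n t ^ 2 := by
      funext t; rw [norm_shellVec_sq]
    rw [h2]
    exact (h1.integrableOn_Icc).mono_set Ioc_subset_Icc_self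
  have hsub : Ioc s₁ s₂ ⊆ Ioc 0 T' := fun t ht => ⟨lt_of_le_of_lt hs₁0 ht.1, ht.2.trans (hs₂t₁.trans ht₁T')⟩
  have hI1 : ∫ t in Ioc s₁ s₂, ‖shellVec X n t‖ ^ 2 ≤ ∫ t in Ioc 0 T', ‖shellVec X n t‖ ^ 2 :=
    setIntegral_mono_set hfint (Eventually.of_forall fun t => sq_nonneg _) hsub.eventuallyLE
  have hcint : IntegrableOn (fun _ : ℝ => (a ^ 2 / 4 : ℝ)) (Ioc s₁ s₂) :=
    ((continuousOn_const (c := (a ^ 2 / 4 : ℝ))).integrableOn_Icc (a := s₁) (b := s₂)).mono_set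
      Ioc_subset_Icc_self
  have hI2 : ∫ t in Ioc s₁ s₂, (a ^ 2 / 4 : ℝ) ≤ ∫ t in Ioc s₁ s₂, ‖shellVec X n t‖ ^ 2 := by
    refine setIntegral_mono_on hcint (hfint.mono_set hsub) measurableSet_Ioc fun t ht => ?_
    have h := habove₁ t ht.1 ht.2
    rw [he] at h
    show a ^ 2 / 4 ≤ ‖shellVec X (n : ℤ) t‖ ^ 2
    linarith
  have hI3 : ∫ t in Ioc s₁ s₂, (a ^ 2 / 4 : ℝ) = (s₂ - s₁) * (a ^ 2 / 4) := by
    rw [← intervalIntegral.integral_of_le hs₁s₂, intervalIntegral.integral_const, smul_eq_mul]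
  have hI : (s₂ - s₁) * (a ^ 2 / 4) ≤ ∫ t in Ioc 0 T', ‖shellVec X n t‖ ^ 2 := by
    rw [← hI3]; exact hI2.trans hI1
  -- assemble: `ρ·∫ ≥ ρ (s₂−s₁) a²/4 ≥ (3a²/8)(a²/4)`
  have hInn : 0 ≤ ∫ t in Ioc 0 T', ‖shellVec X n t‖ ^ 2 := setIntegral_nonneg measurableSet_Ioc fun t _ => sq_nonneg _
  have key : 3 * a ^ 4 / 32 ≤ ρ * ∫ t in Ioc 0 T', ‖shellVec X n t‖ ^ 2 := by
    have h1 : ρ * ((s₂ - s₁) * (a ^ 2 / 4)) ≤ ρ * ∫ t in Ioc 0 T', ‖shellVec X n t‖ ^ 2 :=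
      mul_le_mul_of_nonneg_left hI hρ0.le
    have h2 : 3 * a ^ 2 / 8 * (a ^ 2 / 4) ≤ ρ * (s₂ - s₁) * (a ^ 2 / 4) :=
      mul_le_mul_of_nonneg_right hrise (by positivity)
    linarith [h1, h2]
  rw [hρ] at key
  have key' : a * (3 * a ^ 3) ≤ a * (4096 * w * S * ∫ t in Ioc 0 T', ‖shellVec X n t‖ ^ 2) := by
    linarith [key]
  exact le_of_mul_le_mul_left key' ha

end Summit.NavierStokesRegularity.NavierStokesRegularity.Theorems.EternalRigidityViscBddOne.RiseDissipation

end
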